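import Mathlib
import Literature.NumberTheory.Sieve.RoughOmegaCellsAsymptoticDensity
import Summits.Parity.GeneralizedHardyLittlewood.Theorems.ParityLeakOneFifthPlainSplitTwistedCellSieve
import Summits.Parity.GeneralizedHardyLittlewood.Theorems.ParityLeakOneFifthPlainSplitCellDensityNumerics
import Summits.Parity.GeneralizedHardyLittlewood.Theorems.ParityLeakOneFifthPlainSplitTwistedBoundaryUpper
import HarnessLib

/-!
# Route ParityLeakOneFifth, crux `PlainSplit` (stmt-Parity-18382), skeleton `calib-split`:
# stub `stub_twistedE3Upper` — the twisted `Ω = 3` cell is at most `(23/50 + δ)·V_sh·x/log x`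

Sieve step `twistedCell_sieve_le` (level `z^s`, `C₁e^{−s} ≤ δ/4`; FL + Bombieri–Vinogradov for the
cells) + Alladi's asymptotic `exists_abs_roughCell_sub_main_le` for the `Ω = 3` cell of the
`x^{1/5}`-rough integers at the heights `2x+2` and `x+2` + continuity of `I₃` at `5⁺` and monotonicity
(`u₂ = 5 log(2x+2)/log x → 5`, `u₁ ≥ 5`) + `I₃(5) ≤ 9/20 < 23/50` (`roughCellDensity_three_five_le`).
-/

namespace Summit.Parity.GeneralizedHardyLittlewood.Theorems.ParityLeakOneFifth

open Finset Real
open scoped ArithmeticFunction.Omega Classical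
open Literature.NumberTheory.Sieve

/-- Elementary: `2a/E − a/(E+2) ≤ a/E + 2a/E²` for `a ≥ 0`, `E ≥ 1`. -/
theorem two_div_sub_div_le {a E : ℝ} (ha : 0 ≤ a) (hE : 1 ≤ E) :
    2 * a / E - a / (E + 2) ≤ a / E + 2 * a / E ^ 2 := by
  have hE0 : 0 < E := by linarith
  have hE2 : 0 < E + 2 := by linarith
  have h : a / E + 2 * a / E ^ 2 - (2 * a / E - a / (E + 2)) = 4 * a / (E ^ 2 * (E + 2)) := by
    field_simp
    ring
  have : 0 ≤ 4 * a / (E ^ 2 * (E + 2)) := by positivity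
  linarith

/-- The window of the cell: from Alladi's bounds at the two heights, the continuity/monotonicity of
`I₃` and the sizes of the logarithms. -/
theorem twistedE3_window {c2 c1 I2u I1u I₅ η CA x E lX2 lX1 : ℝ}
    (hc2 : c2 ≤ (2 * x + 2) * I2u / lX2 + CA * (2 * x + 2) / (E / 5) ^ 2)
    (hc1 : (x + 2) * I1u / lX1 - CA * (x + 2) / (E / 5) ^ 2 ≤ c1)
    (hI2 : I2u ≤ I₅ + η) (hI1 : I₅ ≤ I1u) (hI50 : 0 ≤ I₅) (hη0 : 0 ≤ η)
    (hlX2 : E ≤ lX2) (hlX1 : lX1 ≤ E + 2) (hlX1pos : 0 < lX1) (hE : 1 ≤ E) (hx : 1 ≤ x)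
    (hCA : 0 ≤ CA) :
    c2 - c1 ≤ x * I₅ / E + (2 * x * I₅ / E ^ 2 + 2 * x * η / E + 2 * (I₅ + η) / E + 175 * CA * x / E ^ 2) := by
  have hE0 : 0 < E := by linarith
  have hlX2pos : 0 < lX2 := by linarith
  have h1 : (2 * x + 2) * I2u / lX2 ≤ (2 * x + 2) * (I₅ + η) / E := by
    calc (2 * x + 2) * I2u / lX2 ≤ (2 * x + 2) * (I₅ + η) / lX2 :=
          div_le_div_of_nonneg_right (mul_le_mul_of_nonneg_left hI2 (by linarith)) hlX2pos.le
      _ ≤ (2 * x + 2) * (I₅ + η) / E :=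
          div_le_div_of_nonneg_left (by positivity) hE0 hlX2
  have h2 : x * I₅ / (E + 2) ≤ (x + 2) * I1u / lX1 := by
    have hnum : x * I₅ ≤ (x + 2) * I1u := by
      calc x * I₅ ≤ x * I1u := mul_le_mul_of_nonneg_left hI1 (by linarith)
        _ ≤ (x + 2) * I1u := by nlinarith [hI50.trans hI1]
    calc x * I₅ / (E + 2) ≤ (x + 2) * I1u / (E + 2) := div_le_div_of_nonneg_right hnum (by linarith)
      _ ≤ (x + 2) * I1u / lX1 :=
          div_le_div_of_nonneg_left (by nlinarith) hlX1pos hlX1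
  have h3 : CA * (2 * x + 2) / (E / 5) ^ 2 + CA * (x + 2) / (E / 5) ^ 2 ≤ 175 * CA * x / E ^ 2 := by
    rw [show CA * (2 * x + 2) / (E / 5) ^ 2 + CA * (x + 2) / (E / 5) ^ 2 =
      25 * CA * (3 * x + 4) / E ^ 2 by field_simp; ring]
    have : 25 * CA * (3 * x + 4) ≤ 175 * CA * x := by nlinarith
    exact div_le_div_of_nonneg_right this (by positivity)
  have h4 := two_div_sub_div_le (mul_nonneg (by linarith : (0 : ℝ) ≤ x) hI50) hE
  have e : (2 * x + 2) * (I₅ + η) / E = 2 * (x * I₅) / E + 2 * x * η / E + 2 * (I₅ + η) / E := by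
    ring
  have e2 : x * I₅ / (E + 2) = (x * I₅) / (E + 2) := rfl
  rw [show 2 * x * I₅ / E ^ 2 = 2 * (x * I₅) / E ^ 2 by ring]
  linarith

/-- The final arithmetic of `stub_twistedE3Upper` over real variables. -/
theorem twistedE3_arith {B sz V κ errBV x E I₅ η CA δ : ℝ}
    (h1 : B ≤ sz * V * (1 + κ) + errBV)
    (h2 : sz ≤ x * I₅ / E + (2 * x * I₅ / E ^ 2 + 2 * x * η / E + 2 * (I₅ + η) / E + 175 * CA * x / E ^ 2))
    (hV : 0 ≤ V) (hκ0 : 0 ≤ κ) (hκ : κ ≤ δ / 4) (hδ : 0 < δ) (hδ1 : δ ≤ 1) (hη0 : 0 ≤ η)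
    (hη : η ≤ δ / 16) (hI50 : 0 ≤ I₅) (hI5 : I₅ ≤ 9 / 20) (hCA : 0 ≤ CA)
    (hE : 16 * (3 + 350 * CA) / δ ≤ E) (hE1 : 1 ≤ E) (hxE : E ≤ x)
    (herr : errBV ≤ δ / 4 * V * x / E) : B ≤ (23 / 50 + δ) * V * x / E := by
  have hE0 : 0 < E := by linarith
  have hx0 : 0 < x := by linarith
  set Q : ℝ := x / E with hQ
  have hQ0 : 0 < Q := by positivity
  -- the remainder `R`
  set R : ℝ := 2 * x * I₅ / E ^ 2 + 2 * x * η / E + 2 * (I₅ + η) / E + 175 * CA * x / E ^ 2 with hR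
  have hR0 : 0 ≤ R := by positivity
  -- `2R ≤ (δ/2) Q`
  have hEδ : 3 + 350 * CA ≤ δ * E / 16 := by
    rw [div_le_iff₀ hδ] at hE; linarith
  have hR1 : 2 * x * I₅ / E ^ 2 + 175 * CA * x / E ^ 2 = (2 * I₅ + 175 * CA) / E * Q := by
    rw [hQ]; field_simp
  have hR2 : 2 * (I₅ + η) / E ≤ 2 * (I₅ + η) / E * Q / 1 := by
    rw [div_one]
    have : 1 ≤ Q := by rw [hQ, le_div_iff₀ hE0]; linarith
    exact le_mul_of_one_le_right (by positivity) this
  have hR3 : 2 * x * η / E = 2 * η * Q := by rw [hQ]; ring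
  have hRle : 2 * R ≤ δ / 2 * Q := by
    have hA : (2 * I₅ + 175 * CA) / E ≤ δ / 16 := by
      rw [div_le_iff₀ hE0]; nlinarith
    have hB : 2 * (I₅ + η) / E ≤ δ / 16 := by
      rw [div_le_iff₀ hE0]; nlinarith
    have hC : 2 * η ≤ δ / 8 := by linarith
    have e : R = (2 * I₅ + 175 * CA) / E * Q + 2 * η * Q + 2 * (I₅ + η) / E := by
      rw [hR, ← hR1, ← hR3]; ring
    rw [e]
    have t1 : (2 * I₅ + 175 * CA) / E * Q ≤ δ / 16 * Q := mul_le_mul_of_nonneg_right hA hQ0.le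
    have t2 : 2 * η * Q ≤ δ / 8 * Q := mul_le_mul_of_nonneg_right hC hQ0.le
    have t3 : 2 * (I₅ + η) / E ≤ δ / 16 * Q := by
      have := mul_le_mul_of_nonneg_right hB hQ0.le
      rw [div_one] at hR2; linarith
    linarith
  -- `sz (1 + κ) ≤ Q I₅ + κ Q + 2R`
  have hκ1 : κ ≤ 1 := by linarith
  have hsz : sz ≤ Q * I₅ + R := by
    have e : x * I₅ / E = Q * I₅ := by rw [hQ]; ring
    linarith
  have hmain : sz * V * (1 + κ) ≤ (Q * I₅ + κ * Q + 2 * R) * V := by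
    have hpos : 0 ≤ V * (1 + κ) := by positivity
    have s1 : sz * V * (1 + κ) ≤ (Q * I₅ + R) * (V * (1 + κ)) := by
      rw [show sz * V * (1 + κ) = sz * (V * (1 + κ)) by ring]
      exact mul_le_mul_of_nonneg_right hsz hpos
    have s2 : (Q * I₅ + R) * (1 + κ) ≤ Q * I₅ + κ * Q + 2 * R := by
      have f1 : 0 ≤ κ * Q * (1 - I₅) := mul_nonneg (mul_nonneg hκ0 hQ0.le) (by linarith)
      have f2 : R * κ ≤ R := mul_le_of_le_one_right hR0 hκ1
      have e : (Q * I₅ + R) * (1 + κ) = Q * I₅ + R + (κ * Q - κ * Q * (1 - I₅)) + R * κ := by ring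
      rw [e]
      linarith
    calc sz * V * (1 + κ) ≤ (Q * I₅ + R) * (V * (1 + κ)) := s1
      _ = ((Q * I₅ + R) * (1 + κ)) * V := by ring
      _ ≤ (Q * I₅ + κ * Q + 2 * R) * V := mul_le_mul_of_nonneg_right s2 hV
  have herr' : errBV ≤ δ / 4 * V * Q := by rw [hQ]; rwa [show δ / 4 * V * (x / E) = δ / 4 * V * x / E by ring]
  have hfin : (Q * I₅ + κ * Q + 2 * R) * V + δ / 4 * V * Q ≤ (23 / 50 + δ) * V * Q := by
    have p1 : Q * I₅ ≤ Q * (9 / 20) := mul_le_mul_of_nonneg_left hI5 hQ0.le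
    have p2 : κ * Q ≤ δ / 4 * Q := mul_le_mul_of_nonneg_right hκ hQ0.le
    have g : Q * I₅ + κ * Q + 2 * R + δ / 4 * Q ≤ (23 / 50 + δ) * Q := by linarith
    have g' := mul_le_mul_of_nonneg_right g hV
    have e1 : (Q * I₅ + κ * Q + 2 * R) * V + δ / 4 * V * Q =
        (Q * I₅ + κ * Q + 2 * R + δ / 4 * Q) * V := by ring
    have e2 : (23 / 50 + δ) * V * Q = ((23 / 50 + δ) * Q) * V := by ring
    rw [e1, e2]
    exact g'
  calc B ≤ sz * V * (1 + κ) + errBV := h1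
    _ ≤ (Q * I₅ + κ * Q + 2 * R) * V + δ / 4 * V * Q := by linarith
    _ ≤ (23 / 50 + δ) * V * Q := hfin
    _ = (23 / 50 + δ) * V * x / E := by rw [hQ]; ring

/-- `u₂ = log X₂ / (E/5)` is within `ρ` of `5` once `E ≤ log X₂ ≤ E + log 4` and
`5 log 4/ρ + 1 ≤ E`. -/
theorem dist_div_lt {lX2 E ρ L4 : ℝ} (hE0 : 0 < E) (h1 : E ≤ lX2) (h2 : lX2 ≤ L4 + E)
    (hρ : 0 < ρ) (hM : 5 * L4 / ρ + 1 ≤ E) : dist (lX2 / (E / 5)) 5 < ρ := by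
  have hE5 : 0 < E / 5 := by positivity
  have hlo : 5 ≤ lX2 / (E / 5) := by rw [le_div_iff₀ hE5]; linarith
  rw [Real.dist_eq, abs_of_nonneg (by linarith)]
  have hup : lX2 / (E / 5) - 5 ≤ 5 * L4 / E := by
    rw [div_sub' hE5.ne', div_le_div_iff₀ hE5 hE0]; nlinarith
  have h4 : 5 * L4 + ρ ≤ ρ * E := by
    have := mul_le_mul_of_nonneg_left hM hρ.le
    rw [mul_add, mul_div_cancel₀ _ (ne_of_gt hρ), mul_one] at this
    linarith
  have h5 : 5 * L4 / E < ρ := by rw [div_lt_iff₀ hE0]; linarith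
  linarith

/-- The Bombieri–Vinogradov error of the sieve step is `≤ ε V x / log x` (as in the boundary stub). -/
theorem errBV_le_of_growth {C₂ c ε x E t V : ℝ} (hC₂ : 0 ≤ C₂) (hε : 0 < ε) (hx0 : 0 < x)
    (hx1 : 1 ≤ x) (ht : 0 < t) (hE0 : 0 < E) (hl1 : E ≤ Real.log (x + 2)) (hl2 : E ≤ Real.log (2 * x + 2))
    (hV : c / t ^ 4 ≤ V) (hkey : 8 * (C₂ + 1) * t ^ 4 ≤ ε * c * E) :
    C₂ * (2 * x + 2) / Real.log (2 * x + 2) ^ (2 : ℝ) + C₂ * (x + 2) / Real.log (x + 2) ^ (2 : ℝ) ≤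
      ε * V * x / E := by
  have hb1 : C₂ * (x + 2) / Real.log (x + 2) ^ (2 : ℝ) ≤ C₂ * (4 * x) / E ^ 2 := by
    rw [Real.rpow_two]
    calc C₂ * (x + 2) / Real.log (x + 2) ^ 2 ≤ C₂ * (4 * x) / Real.log (x + 2) ^ 2 := by
          gcongr; linarith
      _ ≤ C₂ * (4 * x) / E ^ 2 :=
          div_le_div_of_nonneg_left (by positivity) (pow_pos hE0 2) (pow_le_pow_left₀ hE0.le hl1 2)
  have hb2 : C₂ * (2 * x + 2) / Real.log (2 * x + 2) ^ (2 : ℝ) ≤ C₂ * (4 * x) / E ^ 2 := by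
    rw [Real.rpow_two]
    calc C₂ * (2 * x + 2) / Real.log (2 * x + 2) ^ 2 ≤ C₂ * (4 * x) / Real.log (2 * x + 2) ^ 2 := by
          gcongr; linarith
      _ ≤ C₂ * (4 * x) / E ^ 2 :=
          div_le_div_of_nonneg_left (by positivity) (pow_pos hE0 2) (pow_le_pow_left₀ hE0.le hl2 2)
  have hfin := boundary_errBV_le (C₂ := C₂) hε hx0.le ht hE0 hV hkey
  linarith

set_option maxHeartbeats 800000 in
-- one long assembly of ~20 analytic facts (the arithmetic is factored into the lemmas above)
/-- **Stub `stub_twistedE3Upper` of skeleton `calib-split` of crux `PlainSplit`** (registered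
signature, verbatim): for every `δ > 0` and large `x`, the `z`-rough `n ∈ (x, 2x]` with
`P⁻(n+2) ≥ x^{1/5}` and `Ω(n+2) = 3` number at most `(23/50 + δ)·V_sh·x/log x`.  Sieve step
`twistedCell_sieve_le` at level `z^s` + Alladi's asymptotic for the `Ω = 3` cell of the
`x^{1/5}`-rough integers at the heights `2x+2`, `x+2` + continuity and monotonicity of `I₃` +
`I₃(5) ≤ 9/20`. -/
theorem stub_twistedE3Upper : ∀ δ : ℝ, 0 < δ → ∃ x₀ : ℕ, ∀ x : ℕ, x₀ ≤ x → ∀ (z Vsh : ℝ), z = Real.exp (Real.log (Real.log (x : ℝ)) ^ 2) → Vsh = ∏ p ∈ (Finset.range ⌈z⌉₊).filter (fun p : ℕ => p.Prime ∧ p ≠ 2), (1 - 1 / ((p : ℝ) - 1)) → (#((Finset.Ioc x (2 * x)).filter (fun n : ℕ => (∀ p ∈ n.primeFactors, z ≤ (p : ℝ)) ∧ (x : ℝ) ^ ((1 : ℝ) / 5) ≤ ((n + 2).minFac : ℝ) ∧ ArithmeticFunction.cardFactors (n + 2) = 3)) : ℝ) ≤ (23 / 50 + δ) * Vsh * (x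 : ℝ) / Real.log (x : ℝ) := by
  intro δ₀ hδ₀
  -- work with `δ = min δ₀ 1`
  set δ : ℝ := min δ₀ 1 with hδdef
  have hδ : 0 < δ := lt_min hδ₀ one_pos
  have hδ1 : δ ≤ 1 := min_le_right _ _
  have hδδ₀ : δ ≤ δ₀ := min_le_left _ _
  obtain ⟨C₁, C₂, hC₁, hC₂, hTC⟩ := twistedCell_sieve_le 2 6 2
  obtain ⟨CA, hCA, hAl⟩ := exists_abs_roughCell_sub_main_le 2 6
  obtain ⟨c, hc, hVshlow⟩ := exists_Vsh_lower
  -- continuity of `I₃` at `5`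
  have hcont := Metric.continuousAt_iff.1 (continuousAt_roughCellDensity 3 (by norm_num : (1 : ℝ) < 5))
    (δ / 16) (by positivity)
  obtain ⟨ρ, hρ, hρI⟩ := hcont
  -- the sieve parameter `s ≥ 1` with `C₁ e^{-s} ≤ δ/4`
  obtain ⟨s, hs1, hsC⟩ : ∃ s : ℝ, 1 ≤ s ∧ C₁ * Real.exp (-s) ≤ δ / 4 := by
    refine ⟨max 1 (Real.log (4 * C₁ / δ)), le_max_left _ _, ?_⟩
    have h1 : Real.exp (-max 1 (Real.log (4 * C₁ / δ))) ≤ Real.exp (-Real.log (4 * C₁ / δ)) :=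
      Real.exp_le_exp.2 (neg_le_neg (le_max_right _ _))
    rw [Real.exp_neg (Real.log _), Real.exp_log (by positivity)] at h1
    calc C₁ * Real.exp (-max 1 (Real.log (4 * C₁ / δ)))
        ≤ C₁ * (4 * C₁ / δ)⁻¹ := mul_le_mul_of_nonneg_left h1 hC₁.le
      _ = δ / 4 := by field_simp
  set M : ℝ := max 10 (max (5 * Real.log 4 / ρ + 1) (16 * (3 + 350 * CA) / δ)) with hM
  have hM10 : (10 : ℝ) ≤ M := le_max_left _ _
  have hMρ : 5 * Real.log 4 / ρ + 1 ≤ M := (le_max_left _ _).trans (le_max_right _ _)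
  have hMCA : 16 * (3 + 350 * CA) / δ ≤ M := (le_max_right _ _).trans (le_max_right _ _)
  obtain ⟨T₁, hT₁1, hT₁⟩ := exists_quadratic_le_exp (5 * s) 0 0
  obtain ⟨T₂, -, hT₂⟩ := exists_quadratic_le_exp 0 0 M
  obtain ⟨T₃, -, hT₃⟩ := exists_pow_four_le_mul_exp (κ := δ / 4 * c / (8 * (C₂ + 1))) (by positivity)
  obtain ⟨x₁, hx₁⟩ := exists_nat_loglog_ge (max T₁ (max T₂ T₃))
  refine ⟨x₁, fun x hx => ?_⟩
  rintro z Vsh rfl rfl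
  obtain ⟨hxE, hlogx, hTt⟩ := hx₁ x hx
  set t : ℝ := Real.log (Real.log (x : ℝ)) with ht
  have hT₁t : T₁ ≤ t := le_trans (le_max_left _ _) hTt
  have hT₂t : T₂ ≤ t := le_trans ((le_max_left _ _).trans (le_max_right _ _)) hTt
  have hT₃t : T₃ ≤ t := le_trans ((le_max_right _ _).trans (le_max_right _ _)) hTt
  have ht1 : 1 ≤ t := hT₁1.trans hT₁t
  have ht0 : 0 ≤ t := by linarith
  have hx0 : (0 : ℝ) < x := (Real.exp_pos _).trans_le hxE
  have hx1 : (1 : ℝ) ≤ x := (Real.one_le_exp (Real.exp_pos _).le).trans hxE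
  have hlogpos : 0 < Real.log (x : ℝ) := (Real.exp_pos _).trans_le hlogx
  have hexpt : Real.exp t = Real.log (x : ℝ) := by rw [ht, Real.exp_log hlogpos]
  have hxexp : Real.exp (Real.exp t) = (x : ℝ) := by rw [hexpt, Real.exp_log hx0]
  have hEM : M ≤ Real.exp t := by have := hT₂ t hT₂t; linarith
  have hE10 : (10 : ℝ) ≤ Real.exp t := hM10.trans hEM
  have hEx : Real.exp t ≤ x := by
    have := Real.add_one_le_exp (Real.exp t); rw [hxexp] at this; linarith
  set z : ℝ := Real.exp (t ^ 2) with hz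
  have hz0 : 0 < z := Real.exp_pos _
  have hz2 : 2 < z := by
    have h1 : Real.exp 1 ≤ z := Real.exp_le_exp.2 (by nlinarith)
    have h2 : (2 : ℝ) < Real.exp 1 := by have := Real.exp_one_gt_d9; linarith
    linarith
  have hz1 : 1 ≤ z := by linarith
  have hlogz : Real.log z = t ^ 2 := by rw [hz, Real.log_exp]
  set L : ℝ := z ^ s with hL
  have hzL : z ≤ L := by
    calc z = z ^ (1 : ℝ) := (Real.rpow_one z).symm
      _ ≤ z ^ s := Real.rpow_le_rpow_of_exponent_le hz1 hs1
  have hlogL : Real.log L / Real.log z = s := by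
    rw [hL, Real.log_rpow hz0, hlogz]; field_simp
  have hLexp : L = Real.exp (s * t ^ 2) := by rw [hL, hz, ← Real.exp_mul]; ring_nf
  set Y : ℝ := (x : ℝ) ^ ((1 : ℝ) / 5) with hY
  have hY0 : 0 < Y := Real.rpow_pos_of_pos hx0 _
  have hlogY : Real.log Y = Real.exp t / 5 := by rw [hY, Real.log_rpow hx0, hexpt]; ring
  have hYexp : Y = Real.exp (Real.exp t / 5) := by rw [← Real.exp_log hY0, hlogY]
  have hzY : z ≤ Y := by
    rw [hYexp, hz]; refine Real.exp_le_exp.2 ?_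
    have := hT₁ t hT₁t; nlinarith
  have hL4 : L ≤ ((x : ℝ) + 2) ^ ((1 : ℝ) / 4) := by
    have h1 : L ≤ (x : ℝ) ^ ((1 : ℝ) / 4) := by
      rw [hLexp, ← hxexp, ← Real.exp_mul]; refine Real.exp_le_exp.2 ?_
      have := hT₁ t hT₁t; nlinarith
    exact h1.trans (Real.rpow_le_rpow hx0.le (by linarith) (by norm_num))
  have hY2 : 2 ≤ Y := by linarith
  have hYx : Y ≤ (x : ℝ) + 2 := by
    have : Y ≤ (x : ℝ) := by
      rw [hY]; calc (x : ℝ) ^ ((1 : ℝ) / 5) ≤ (x : ℝ) ^ (1 : ℝ) :=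
            Real.rpow_le_rpow_of_exponent_le hx1 (by norm_num)
        _ = x := Real.rpow_one _
    linarith
  have hlog4 : Real.log (2 * (x : ℝ) + 2) ≤ Real.log 4 + Real.log x := by
    rw [← Real.log_mul (by norm_num) hx0.ne']; exact Real.log_le_log (by positivity) (by linarith)
  have hl4 : Real.log 4 ≤ 2 := by
    have := Real.log_two_lt_d9
    rw [show (4 : ℝ) = 2 ^ 2 by norm_num, Real.log_pow]; push_cast; linarith
  have hl40 : 0 < Real.log 4 := Real.log_pos (by norm_num)
  have hlog6 : Real.log (2 * (x : ℝ) + 2) ≤ (6 : ℕ) * Real.log Y := by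
    rw [hlogY, ← hexpt] at *; push_cast; linarith
  set Vsh : ℝ := ∏ p ∈ (Finset.range ⌈z⌉₊).filter (fun p : ℕ => p.Prime ∧ p ≠ 2),
    (1 - 1 / ((p : ℝ) - 1)) with hVsh
  have hVshc : c / t ^ 4 ≤ Vsh := by
    have h := hVshlow z hz2; rw [hlogz, show (t ^ 2) ^ 2 = t ^ 4 by ring] at h; exact h
  have ht4 : 0 < t ^ 4 := by positivity
  have hVsh0 : 0 < Vsh := lt_of_lt_of_le (div_pos hc ht4) hVshc
  -- the densities: `u₂ → 5⁺`, `u₁ ≥ 5`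
  set I₅ : ℝ := roughCellDensity 3 5 with hI₅
  have hI50 : 0 ≤ I₅ := roughCellDensity_nonneg _ _
  have hI5 : I₅ ≤ 9 / 20 := roughCellDensity_three_five_le
  set u₂ : ℝ := Real.log ((2 * x + 2 : ℕ) : ℝ) / Real.log Y with hu₂
  set u₁ : ℝ := Real.log ((x + 2 : ℕ) : ℝ) / Real.log Y with hu₁
  have hlogYpos : 0 < Real.log Y := by rw [hlogY]; positivity
  have hlX2 : Real.exp t ≤ Real.log ((2 * x + 2 : ℕ) : ℝ) := by
    rw [hexpt]; push_cast; exact Real.log_le_log hx0 (by linarith)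
  have hlX1lo : Real.exp t ≤ Real.log ((x + 2 : ℕ) : ℝ) := by
    rw [hexpt]; push_cast; exact Real.log_le_log hx0 (by linarith)
  have hlX1 : Real.log ((x + 2 : ℕ) : ℝ) ≤ Real.exp t + 2 := by
    have h3 : Real.log ((x + 2 : ℕ) : ℝ) ≤ Real.log 4 + Real.log x := by
      push_cast
      rw [← Real.log_mul (by norm_num) hx0.ne']; exact Real.log_le_log (by positivity) (by linarith)
    linarith [h3, hl4, hexpt]
  have hu₁5 : 5 ≤ u₁ := by
    rw [hu₁, le_div_iff₀ hlogYpos, hlogY]; linarith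
  have hu₂5 : 5 ≤ u₂ := by
    rw [hu₂, le_div_iff₀ hlogYpos, hlogY]; linarith
  have hu₂ρ : dist u₂ 5 < ρ := by
    have h2 : Real.log ((2 * x + 2 : ℕ) : ℝ) ≤ Real.log 4 + Real.exp t := by
      rw [hexpt]; push_cast; exact hlog4
    have h := dist_div_lt (Real.exp_pos t) hlX2 h2 hρ (hMρ.trans hEM)
    rw [hu₂, hlogY]; exact h
  have hI2u : roughCellDensity 3 u₂ ≤ I₅ + δ / 16 := by
    have := hρI hu₂ρ
    rw [Real.dist_eq] at this
    have := (abs_lt.1 this).2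
    linarith
  have hI1u : I₅ ≤ roughCellDensity 3 u₁ := monotone_roughCellDensity 3 hu₁5
  -- error terms (`errBV ≤ (δ/4) Vsh x / E`)
  have herrBV : C₂ * (2 * (x : ℝ) + 2) / Real.log (2 * (x : ℝ) + 2) ^ (2 : ℝ) +
      C₂ * ((x : ℝ) + 2) / Real.log ((x : ℝ) + 2) ^ (2 : ℝ) ≤ δ / 4 * Vsh * x / Real.exp t := by
    have h3 := hT₃ t hT₃t
    have hkey : 8 * (C₂ + 1) * t ^ 4 ≤ δ / 4 * c * Real.exp t := by
      have := mul_le_mul_of_nonneg_left h3 (by positivity : (0 : ℝ) ≤ 8 * (C₂ + 1))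
      have e : 8 * (C₂ + 1) * (δ / 4 * c / (8 * (C₂ + 1)) * Real.exp t) = δ / 4 * c * Real.exp t := by
        field_simp
      linarith [e.symm.le]
    have hl1 : Real.exp t ≤ Real.log ((x : ℝ) + 2) := by
      rw [hexpt]; exact Real.log_le_log hx0 (by linarith)
    have hl2 : Real.exp t ≤ Real.log (2 * (x : ℝ) + 2) := by
      rw [hexpt]; exact Real.log_le_log hx0 (by linarith)
    exact errBV_le_of_growth hC₂ (by positivity) hx0 hx1 (by linarith) (Real.exp_pos t) hl1 hl2 hVshc hkey
  -- Alladi at the two heights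
  have hYX2 : Y ≤ ((2 * x + 2 : ℕ) : ℝ) := by push_cast; linarith only [hYx]
  have hYX1 : Y ≤ ((x + 2 : ℕ) : ℝ) := by push_cast; linarith only [hYx]
  have hlogk2 : Real.log ((2 * x + 2 : ℕ) : ℝ) ≤ (6 : ℕ) * Real.log Y := by push_cast; exact hlog6
  have hlogk1 : Real.log ((x + 2 : ℕ) : ℝ) ≤ (6 : ℕ) * Real.log Y := by
    refine le_trans (Real.log_le_log (by positivity) ?_) hlogk2; push_cast; linarith only [hx0]
  have hA2 := hAl ((2 * x + 2 : ℕ) : ℝ) Y hY2 hYX2 hlogk2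
  have hA1 := hAl ((x + 2 : ℕ) : ℝ) Y hY2 hYX1 hlogk1
  rw [Nat.floor_natCast] at hA2 hA1
  simp only [show (2 : ℕ) ≠ 0 from two_ne_zero, if_false, sub_zero] at hA2 hA1
  have hc2 := (abs_le.1 hA2).2
  have hc1 := (abs_le.1 hA1).1
  -- the sieve step at level `L = z^s`
  have hTw := hTC x z L Y hz2 hzL hzY hYx (by push_cast at hlog6 ⊢; exact hlog6) hL4
  rw [hlogL] at hTw
  have hsubB : (Finset.Ioc x (2 * x)).filter (fun n : ℕ => (∀ p ∈ n.primeFactors, z ≤ (p : ℝ)) ∧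
      (x : ℝ) ^ ((1 : ℝ) / 5) ≤ ((n + 2).minFac : ℝ) ∧ ArithmeticFunction.cardFactors (n + 2) = 3) ⊆
      (Finset.Ioc x (2 * x)).filter (fun m : ℕ => (∀ p ∈ m.primeFactors, z ≤ (p : ℝ)) ∧
        ⌈Y⌉₊ ≤ (m + 2).minFac ∧ ArithmeticFunction.cardFactors (m + 2) = 2 + 1) := by
    intro n hn
    rw [Finset.mem_filter] at hn ⊢
    exact ⟨hn.1, hn.2.1, Nat.ceil_le.2 hn.2.2.1, hn.2.2.2⟩
  have hcard : (#((Finset.Ioc x (2 * x)).filter (fun n : ℕ => (∀ p ∈ n.primeFactors, z ≤ (p : ℝ)) ∧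
      (x : ℝ) ^ ((1 : ℝ) / 5) ≤ ((n + 2).minFac : ℝ) ∧ ArithmeticFunction.cardFactors (n + 2) = 3)) : ℝ) ≤
      #((Finset.Ioc x (2 * x)).filter (fun m : ℕ => (∀ p ∈ m.primeFactors, z ≤ (p : ℝ)) ∧
        ⌈Y⌉₊ ≤ (m + 2).minFac ∧ ArithmeticFunction.cardFactors (m + 2) = 2 + 1)) := by
    exact_mod_cast Finset.card_le_card hsubB
  have hB := hcard.trans hTw
  -- the window and the final arithmetic
  have hlX2' : Real.exp t ≤ Real.log (2 * (x : ℝ) + 2) := by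
    have h := hlX2; push_cast at h; exact h
  have hlX1' : Real.log ((x : ℝ) + 2) ≤ Real.exp t + 2 := by
    have h := hlX1; push_cast at h; exact h
  have hlX1lo' : Real.exp t ≤ Real.log ((x : ℝ) + 2) := by
    have h := hlX1lo; push_cast at h; exact h
  have hc2' : (((#((roughIcc ⌈Y⌉₊ (2 * x + 2)).filter
      (fun b => ArithmeticFunction.cardFactors b = 2 + 1))) : ℕ) : ℝ) ≤
      (2 * (x : ℝ) + 2) * roughCellDensity 3 u₂ / Real.log (2 * (x : ℝ) + 2) +
        CA * (2 * (x : ℝ) + 2) / (Real.exp t / 5) ^ 2 := by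
    have h := hc2
    rw [← hu₂, hlogY] at h
    push_cast at h
    linarith only [h]
  have hc1' : ((x : ℝ) + 2) * roughCellDensity 3 u₁ / Real.log ((x : ℝ) + 2) -
      CA * ((x : ℝ) + 2) / (Real.exp t / 5) ^ 2 ≤
      (((#((roughIcc ⌈Y⌉₊ (x + 2)).filter
        (fun b => ArithmeticFunction.cardFactors b = 2 + 1))) : ℕ) : ℝ) := by
    have h := hc1
    rw [← hu₁, hlogY] at h
    push_cast at h
    linarith only [h]
  have hwin := twistedE3_window hc2' hc1' hI2u hI1u hI50 (by positivity) hlX2' hlX1'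
    ((Real.exp_pos t).trans_le hlX1lo') (by linarith) hx1 hCA
  have hκ : C₁ * Real.exp (-s) ≤ δ / 4 := hsC
  have hres := twistedE3_arith hB hwin hVsh0.le (by positivity)
    hκ hδ hδ1 (by positivity) (le_refl _) hI50 hI5 hCA (hMCA.trans hEM) (by linarith) hEx
    herrBV
  rw [← hexpt]
  refine hres.trans ?_
  have hQ : 0 ≤ Vsh * (x : ℝ) / Real.exp t := by positivity
  have : (23 / 50 + δ) * Vsh * (x : ℝ) / Real.exp t ≤ (23 / 50 + δ₀) * Vsh * (x : ℝ) / Real.exp t := by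
    rw [show (23 / 50 + δ) * Vsh * (x : ℝ) / Real.exp t = (23 / 50 + δ) * (Vsh * x / Real.exp t) by ring,
      show (23 / 50 + δ₀) * Vsh * (x : ℝ) / Real.exp t = (23 / 50 + δ₀) * (Vsh * x / Real.exp t) by ring]
    exact mul_le_mul_of_nonneg_right (by linarith) hQ
  exact this

end Summit.Parity.GeneralizedHardyLittlewood.Theorems.ParityLeakOneFifth
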